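import Literature.Geometry.Lorentzian.KerrCylinderAxialSymmetry
import Mathlib.LinearAlgebra.CrossProduct
import HarnessLib

/-!
# The first-order spin terms are linear in the spin VECTOR

Support file (all results proved; no named facts) for the named fact `LiMei.interiorKerrGluing`
(`InteriorKerrGluing.lean`; J. Li, H. Mei, *A construction of collapsing spacetimes in vacuum*,
Comm. Math. Phys. 378 (2020) = arXiv:2005.01249, Prop. 4.1). Li–Mei parametrise the Kerr family
by `(m, a⃗) ∈ ℝ⁺ × ℝ³`, `a⃗ = a·(axis)`, and use that the obstruction map is, to first order,
LINEAR in `a⃗`: `𝓘 = (8π(m − m₀), −8π m₀ a⃗) + …` (loc. cit. p. 25). In the tree the family is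
`b ↦ (a, R) = (‖b‖, spinIsometry b)` (`InteriorKerrGluingReduction.lean`; `R (b/‖b‖) = ∂₃`,
`det R = 1`), and the first-order spin terms of Li–Mei (4.2) (`hasDerivAt_cylH₀_spin_isometry`,
`hasDerivAt_cylK₀_spin_isometry`) carry the factor `(Ry)₁(Rv)₀ − (Ry)₀(Rv)₁`. This file proves

  `‖b‖ · ((Ry)₁(Rv)₀ − (Ry)₀(Rv)₁) = −b · (y × v)`   (`LiMei.norm_mul_spinIsometry_swirl`),

a triple product, hence LINEAR in `b` (and the same for the second chart `spinIsometry₂`): the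
quantity `(Ry)₁(Rv)₀ − (Ry)₀(Rv)₁ = −∂₃ · (Ry × Rv) = −det(R(b/‖b‖), Ry, Rv) = −det R · (b/‖b‖)·(y × v)`.
Consequently `a · (first-order spin term at the axis of b)`, `a = ‖b‖`, is the linear functional
`b ↦ −(2m/(r₀‖y‖³))(b·(y × v) ⟪y, w⟫ + ⟪y, v⟫ b·(y × w))` for the metric
(`LiMei.norm_mul_firstOrderH_spinIsometry`) and its `M(2M/r₀ − 1)^{1/2}/(r₀²‖y‖³)` multiple for the
second fundamental form.

## References

* J. Li, H. Mei, arXiv:2005.01249, §4, p. 22 and p. 25 (key `LiMei2020`).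
-/

noncomputable section

open Set Function Matrix
open scoped RealInnerProductSpace

namespace Literature.Geometry.Lorentzian

namespace LiMei

/-! ### The triple product on `E3` and its invariance under isometries of determinant one -/

/-- The triple product `u · (y × v)` of three vectors of `E3` (Mathlib's `crossProduct` and
`dotProduct` on the underlying functions). [folklore] -/
def triple (u y v : E3) : ℝ :=
  WithLp.ofLp u ⬝ᵥ (crossProduct (WithLp.ofLp y) (WithLp.ofLp v))

/-- The triple product in components. [folklore] -/
theorem triple_eq (u y v : E3) :
    triple u y v = u 0 * (y 1 * v 2 - y 2 * v 1) + u 1 * (y 2 * v 0 - y 0 * v 2) +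
      u 2 * (y 0 * v 1 - y 1 * v 0) := by
  rw [triple, cross_apply, dotProduct, Fin.sum_univ_three]
  simp

/-- The triple product is the determinant of the standard basis applied to the three vectors.
[folklore] -/
theorem triple_eq_basis_det (u y v : E3) :
    triple u y v = (EuclideanSpace.basisFun (Fin 3) ℝ).toBasis.det ![u, y, v] := by
  rw [Module.Basis.det_apply, triple, triple_product_eq_det, ← Matrix.det_transpose]
  congr 1
  ext i j
  rw [Module.Basis.toMatrix_apply, OrthonormalBasis.coe_toBasis_repr_apply, EuclideanSpace.basisFun_repr,
    Matrix.transpose_apply]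
  fin_cases i <;> fin_cases j <;> rfl

/-- **The triple product is invariant under linear maps of determinant one**:
`(Su)·(Sy × Sv) = det S · u·(y × v)`. [folklore] -/
theorem triple_map (S : E3 →ₗ[ℝ] E3) (u y v : E3) :
    triple (S u) (S y) (S v) = LinearMap.det S * triple u y v := by
  rw [triple_eq_basis_det, triple_eq_basis_det, ← Module.Basis.det_comp]
  congr 1
  ext i : 1
  fin_cases i <;> rfl

/-- The triple product is linear in the first slot: as an inner product with the cross product
vector. [folklore] -/
theorem triple_eq_inner (u y v : E3) :
    triple u y v = ⟪u, WithLp.toLp 2 (crossProduct (WithLp.ofLp y) (WithLp.ofLp v))⟫ := by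
  rw [triple, EuclideanSpace.inner_eq_star_dotProduct]
  simp [dotProduct_comm]

/-- `∂₃ · (y × v) = y₀ v₁ − y₁ v₀`. [folklore] -/
theorem triple_axisVec (y v : E3) : triple axisVec y v = y 0 * v 1 - y 1 * v 0 := by
  rw [triple_eq]
  simp [axisVec]

/-! ### The first-order spin factor through `spinIsometry` -/

/-- **`‖b‖ ((Ry)₁(Rv)₀ − (Ry)₀(Rv)₁) = −b·(y × v)`** for `R = spinIsometry b`, `b ≠ 0`: the
first-order spin factor of Li–Mei (4.2), multiplied by the spin `a = ‖b‖`, is the linear functional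
`b ↦ −b·(y × v)`. [cite: LiMei2020, p. 25] -/
theorem norm_mul_spinIsometry_swirl {b : E3} (hb : b ≠ 0) (y v : E3) :
    ‖b‖ * (spinIsometry b y 1 * spinIsometry b v 0 - spinIsometry b y 0 * spinIsometry b v 1) =
      -triple b y v := by
  have hn : ‖b‖ ≠ 0 := norm_ne_zero_iff.2 hb
  -- `(Ry)₀(Rv)₁ − (Ry)₁(Rv)₀ = ∂₃·(Ry × Rv) = (R(b/‖b‖))·(Ry × Rv) = det R · (b/‖b‖)·(y × v)`
  have h1 : triple axisVec (spinIsometry b y) (spinIsometry b v) =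
      spinIsometry b y 0 * spinIsometry b v 1 - spinIsometry b y 1 * spinIsometry b v 0 :=
    triple_axisVec _ _
  have h2 : triple axisVec (spinIsometry b y) (spinIsometry b v) = ‖b‖⁻¹ * triple b y v := by
    rw [← spinIsometry_apply_dir hb]
    have h := triple_map (spinIsometry b).toLinearMap (‖b‖⁻¹ • b) y v
    simp only [LinearIsometry.coe_toLinearMap] at h
    rw [h, det_spinIsometry, one_mul, triple, WithLp.ofLp_smul, smul_dotProduct, smul_eq_mul, triple]
  have h3 : spinIsometry b y 1 * spinIsometry b v 0 - spinIsometry b y 0 * spinIsometry b v 1 =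
      -(‖b‖⁻¹ * triple b y v) := by rw [← h2, h1]; ring
  rw [h3]
  field_simp

/-- The same for the second chart `spinIsometry₂`. [cite: LiMei2020, p. 25] -/
theorem norm_mul_spinIsometry₂_swirl {b : E3} (hb : b ≠ 0) (y v : E3) :
    ‖b‖ * (spinIsometry₂ b y 1 * spinIsometry₂ b v 0 - spinIsometry₂ b y 0 * spinIsometry₂ b v 1) =
      -triple b y v := by
  have hn : ‖b‖ ≠ 0 := norm_ne_zero_iff.2 hb
  have h1 : triple axisVec (spinIsometry₂ b y) (spinIsometry₂ b v) =
      spinIsometry₂ b y 0 * spinIsometry₂ b v 1 - spinIsometry₂ b y 1 * spinIsometry₂ b v 0 :=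
    triple_axisVec _ _
  have h2 : triple axisVec (spinIsometry₂ b y) (spinIsometry₂ b v) = ‖b‖⁻¹ * triple b y v := by
    rw [← spinIsometry₂_apply_dir hb]
    have h := triple_map (spinIsometry₂ b).toLinearMap (‖b‖⁻¹ • b) y v
    simp only [LinearIsometry.coe_toLinearMap] at h
    rw [h, det_spinIsometry₂, one_mul, triple, WithLp.ofLp_smul, smul_dotProduct, smul_eq_mul, triple]
  have h3 : spinIsometry₂ b y 1 * spinIsometry₂ b v 0 - spinIsometry₂ b y 0 * spinIsometry₂ b v 1 =
      -(‖b‖⁻¹ * triple b y v) := by rw [← h2, h1]; ring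
  rw [h3]
  field_simp

/-- **The first-order spin term of the metric is linear in the spin vector**: with `a = ‖b‖` and
`R = spinIsometry b`,
`a · 2m/(r₀‖y‖³) ((Ry)₁(Rv)₀ − (Ry)₀(Rv)₁)⟪y, w⟫ + ⟪y, v⟫((Ry)₁(Rw)₀ − (Ry)₀(Rw)₁))
 = −2m/(r₀‖y‖³) (b·(y × v) ⟪y, w⟫ + ⟪y, v⟫ b·(y × w))` (the right-hand side is linear in `b` and
makes sense at `b = 0`). [cite: LiMei2020, p. 25] -/
theorem norm_mul_firstOrderH_spinIsometry (m r₀ : ℝ) {b : E3} (hb : b ≠ 0) (y v w : E3) :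
    ‖b‖ * (2 * m / (r₀ * ‖y‖ ^ 3) *
        ((spinIsometry b y 1 * spinIsometry b v 0 - spinIsometry b y 0 * spinIsometry b v 1) * ⟪y, w⟫ +
          ⟪y, v⟫ * (spinIsometry b y 1 * spinIsometry b w 0 - spinIsometry b y 0 * spinIsometry b w 1))) =
      -(2 * m / (r₀ * ‖y‖ ^ 3)) * (triple b y v * ⟪y, w⟫ + ⟪y, v⟫ * triple b y w) := by
  have hv := norm_mul_spinIsometry_swirl hb y v
  have hw := norm_mul_spinIsometry_swirl hb y w
  have e : ‖b‖ * (2 * m / (r₀ * ‖y‖ ^ 3) *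
      ((spinIsometry b y 1 * spinIsometry b v 0 - spinIsometry b y 0 * spinIsometry b v 1) * ⟪y, w⟫ +
        ⟪y, v⟫ * (spinIsometry b y 1 * spinIsometry b w 0 - spinIsometry b y 0 * spinIsometry b w 1))) =
      2 * m / (r₀ * ‖y‖ ^ 3) *
        ((‖b‖ * (spinIsometry b y 1 * spinIsometry b v 0 - spinIsometry b y 0 * spinIsometry b v 1)) *
            ⟪y, w⟫ +
          ⟪y, v⟫ * (‖b‖ * (spinIsometry b y 1 * spinIsometry b w 0 -
            spinIsometry b y 0 * spinIsometry b w 1))) := by ring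
  rw [e, hv, hw]
  ring

/-- **The first-order spin term of the second fundamental form is linear in the spin vector**
(same factor, coefficient `M(2M/r₀ − 1)^{1/2}/(r₀²‖y‖³)`). [cite: LiMei2020, p. 25] -/
theorem norm_mul_firstOrderK_spinIsometry (M r₀ : ℝ) {b : E3} (hb : b ≠ 0) (y v w : E3) :
    ‖b‖ * (M * Real.sqrt (2 * M / r₀ - 1) / (r₀ ^ 2 * ‖y‖ ^ 3) *
        ((spinIsometry b y 1 * spinIsometry b v 0 - spinIsometry b y 0 * spinIsometry b v 1) * ⟪y, w⟫ +
          ⟪y, v⟫ * (spinIsometry b y 1 * spinIsometry b w 0 - spinIsometry b y 0 * spinIsometry b w 1))) =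
      -(M * Real.sqrt (2 * M / r₀ - 1) / (r₀ ^ 2 * ‖y‖ ^ 3)) *
        (triple b y v * ⟪y, w⟫ + ⟪y, v⟫ * triple b y w) := by
  have hv := norm_mul_spinIsometry_swirl hb y v
  have hw := norm_mul_spinIsometry_swirl hb y w
  have e : ‖b‖ * (M * Real.sqrt (2 * M / r₀ - 1) / (r₀ ^ 2 * ‖y‖ ^ 3) *
      ((spinIsometry b y 1 * spinIsometry b v 0 - spinIsometry b y 0 * spinIsometry b v 1) * ⟪y, w⟫ +
        ⟪y, v⟫ * (spinIsometry b y 1 * spinIsometry b w 0 - spinIsometry b y 0 * spinIsometry b w 1))) =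
      M * Real.sqrt (2 * M / r₀ - 1) / (r₀ ^ 2 * ‖y‖ ^ 3) *
        ((‖b‖ * (spinIsometry b y 1 * spinIsometry b v 0 - spinIsometry b y 0 * spinIsometry b v 1)) *
            ⟪y, w⟫ +
          ⟪y, v⟫ * (‖b‖ * (spinIsometry b y 1 * spinIsometry b w 0 -
            spinIsometry b y 0 * spinIsometry b w 1))) := by ring
  rw [e, hv, hw]
  ring

end LiMei

end Literature.Geometry.Lorentzian

end
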